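import Summits.CriticalPhenomena.PercolationContinuityZ3.Theorems.PercNearOneGluingNoHeavyLowerTailIncStarEdgeReduction
import Summits.CriticalPhenomena.PercolationContinuityZ3.Theorems.PercNearOneGluingNoHeavyLowerTailIncStarAnyPairTangent
import Mathlib.Algebra.Order.BigOperators.Group.Finset
import HarnessLib

/-!
# The increasing star from ONE above-chord pair per weighted graph (E₃ form) and from the AGGREGATE chord defect
# (Sahi programme, prover prim-sahi-p2 gen 42)

Support file (`--supports stmt-CriticalPhenomena-4575`, helper).  No definitions, no named facts, no sorries; standard axioms.
Memo `run/shared/lean/prim/prim-sahi/FROM-prim-sahi-p2-gen42-HALVING-FIBRE.md` §1; `prim-sahi-p2/PROOF-E3.md` §52.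

By the one-bond identity (`IncStar.sahiE3_oneBond_identity`, prim-sahi-p2 gen 4)
`E₃(P_w) = (1−p)·E₃(P_{w[e↦0]}) + p·E₃(P_{w[e↦1]}) + p(1−p)·Λ_e(w)` along ANY pair `e` (`p = w e`), an induction on the number of
fractional pairs closes as soon as every weight with a fractional pair has AT LEAST ONE fractional pair (chosen per weight and per marking)
along which `E₃` lies above its chord:

* `sahiE3_nonneg_of_existsEdgeChord` — for three arbitrary events `A B C`;
* **`incStar_of_existsEdgeChord`** — the increasing star `E₃({s↔b},{s↔c},{s↔y}) ≥ 0` from the hypothesis for the star events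
  (CONJECTURE ∃-EDGE-CHORD; the universal form "along EVERY pair", `incStar_nonneg_of_edgeChord`, is FALSE for some weighted graphs with
  `n ≥ 8` vertices — ttrl2 cp-istar family `W2(k)` — while "some good pair per weighted marked graph" has never failed: exhaustively true for
  `n ≤ 7`, adversarial no-good-edge searches `n ≤ 10`, ttrl2 kit j096086);
* **`incStar_of_aggregateEdgeChord`** — the increasing star from the AGGREGATE hypothesis
  `0 ≤ Σ_e [E₃(P_w) − (1 − w e)·E₃(P_{w[e↦0]}) − (w e)·E₃(P_{w[e↦1]})] = Σ_e w_e(1−w_e)·Λ_e(w)` (sum over all pairs; non-fractional pairs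
  contribute `0`): a nonnegative sum has a nonnegative term.  The aggregate is `−(d/dρ)|_{ρ=0}` of the three-copy functional in which every
  pair is shared by the three copies independently with probability `ρ` (`ρ = 1` gives `0`), so the hypothesis says that infinitesimal
  sharing does not increase `E₃` (CONJECTURE AGG-E₃ of the memo; its C5 analogue is FALSE in thin corners, memo §1).

Nothing here asserts either conjecture.
-/

noncomputable section

namespace Summit.CriticalPhenomena.PercolationContinuityZ3.Theorems

namespace IncStar

open MeasureTheory Set Literature.Probability.Percolation Literature.Probability.LatticeModels EdgeInduction
open scoped Classical

variable {n : ℕ}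

/-- **`E₃ ≥ 0` FROM ONE ABOVE-CHORD PAIR PER WEIGHT.**  Fix events `A B C`.  If every weight `v` with a fractional pair has a fractional pair `e`
with `(1 − v e)·E₃(P_{v[e↦0]}) + (v e)·E₃(P_{v[e↦1]}) ≤ E₃(P_v)`, then `E₃(P_w)(A,B,C) ≥ 0` for every weight `w`. [this work] -/
theorem sahiE3_nonneg_of_existsEdgeChord (A B C : Set (BondConfig (Fin n)))
    (hEx : ∀ v : Sym2 (Fin n) → unitInterval, (fracEdges v).Nonempty → ∃ e ∈ fracEdges v,
      (1 - (v e : ℝ)) * sahiE3 (prodBernoulli (Function.update v e 0)) A B C +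
          (v e : ℝ) * sahiE3 (prodBernoulli (Function.update v e 1)) A B C ≤
        sahiE3 (prodBernoulli v) A B C)
    (w : Sym2 (Fin n) → unitInterval) : 0 ≤ sahiE3 (prodBernoulli w) A B C := by
  suffices H : ∀ (k : ℕ) (v : Sym2 (Fin n) → unitInterval), (fracEdges v).card ≤ k → 0 ≤ sahiE3 (prodBernoulli v) A B C from
    H _ w le_rfl
  intro k
  induction k with
  | zero =>
      intro v hk
      have hv : ∀ e, v e = 0 ∨ v e = 1 := fun e => eq_zero_or_one_of_not_mem_fracEdges fun he => by
        have : 0 < (fracEdges v).card := Finset.card_pos.2 ⟨e, he⟩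
        omega
      rw [sahiE3_eq_zero_of_zeroOne v hv]
  | succ k ih =>
      intro v hk
      by_cases hne : (fracEdges v).Nonempty
      · obtain ⟨e, he, hchord⟩ := hEx v hne
        have h0 := ih (Function.update v e 0) (by have := card_fracEdges_update_lt' v he 0 (Or.inl rfl); omega)
        have h1 := ih (Function.update v e 1) (by have := card_fracEdges_update_lt' v he 1 (Or.inr rfl); omega)
        have hp0 : 0 ≤ (v e : ℝ) := (v e).2.1
        have hp1 : (v e : ℝ) ≤ 1 := (v e).2.2
        calc (0 : ℝ) ≤ (1 - (v e : ℝ)) * sahiE3 (prodBernoulli (Function.update v e 0)) A B C +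
              (v e : ℝ) * sahiE3 (prodBernoulli (Function.update v e 1)) A B C := by
                have : 0 ≤ 1 - (v e : ℝ) := by linarith
                positivity
          _ ≤ sahiE3 (prodBernoulli v) A B C := hchord
      · rw [Finset.not_nonempty_iff_eq_empty] at hne
        exact ih v (by rw [hne, Finset.card_empty]; exact Nat.zero_le _)

/-- **THE INCREASING STAR FROM ONE ABOVE-CHORD PAIR PER WEIGHTED MARKED GRAPH** (CONJECTURE ∃-EDGE-CHORD ⟹ ISTAR).  If for every weight `v`
with a fractional pair and all `s b c y` some fractional pair `e` satisfies the chord inequality of the star cubic `p_e ↦ E₃(P_v)({s↔b},{s↔c},{s↔y})`,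
then the increasing star is nonnegative on every weighted graph on `Fin n`. [this work] -/
theorem incStar_of_existsEdgeChord
    (hEx : ∀ (v : Sym2 (Fin n) → unitInterval) (s b c y : Fin n), (fracEdges v).Nonempty → ∃ e ∈ fracEdges v,
      (1 - (v e : ℝ)) * sahiE3 (prodBernoulli (Function.update v e 0)) (openConn s b) (openConn s c) (openConn s y) +
          (v e : ℝ) * sahiE3 (prodBernoulli (Function.update v e 1)) (openConn s b) (openConn s c) (openConn s y) ≤
        sahiE3 (prodBernoulli v) (openConn s b) (openConn s c) (openConn s y))
    (w : Sym2 (Fin n) → unitInterval) (s b c y : Fin n) :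
    0 ≤ sahiE3 (prodBernoulli w) (openConn s b) (openConn s c) (openConn s y) :=
  sahiE3_nonneg_of_existsEdgeChord _ _ _ (fun v hv => hEx v s b c y hv) w

/-- **THE INCREASING STAR FROM THE AGGREGATE CHORD DEFECT** (CONJECTURE AGG-E₃ ⟹ ISTAR).  If for every weight `v` and all `s b c y` the sum over
all pairs `e` of the chord defects `E₃(P_v) − (1 − v e)·E₃(P_{v[e↦0]}) − (v e)·E₃(P_{v[e↦1]})` (`= v_e(1−v_e)·Λ_e(v)`) of the star cubic is
nonnegative, then the increasing star is nonnegative on every weighted graph on `Fin n`. [this work] -/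
theorem incStar_of_aggregateEdgeChord
    (hAgg : ∀ (v : Sym2 (Fin n) → unitInterval) (s b c y : Fin n),
      0 ≤ ∑ e : Sym2 (Fin n),
        (sahiE3 (prodBernoulli v) (openConn s b) (openConn s c) (openConn s y) -
          ((1 - (v e : ℝ)) * sahiE3 (prodBernoulli (Function.update v e 0)) (openConn s b) (openConn s c) (openConn s y) +
            (v e : ℝ) * sahiE3 (prodBernoulli (Function.update v e 1)) (openConn s b) (openConn s c) (openConn s y))))
    (w : Sym2 (Fin n) → unitInterval) (s b c y : Fin n) :
    0 ≤ sahiE3 (prodBernoulli w) (openConn s b) (openConn s c) (openConn s y) := by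
  refine incStar_of_existsEdgeChord (fun v s b c y hne => ?_) w s b c y
  -- abbreviate the chord defect of the pair `e`
  set D : Sym2 (Fin n) → ℝ := fun e =>
    sahiE3 (prodBernoulli v) (openConn s b) (openConn s c) (openConn s y) -
      ((1 - (v e : ℝ)) * sahiE3 (prodBernoulli (Function.update v e 0)) (openConn s b) (openConn s c) (openConn s y) +
        (v e : ℝ) * sahiE3 (prodBernoulli (Function.update v e 1)) (openConn s b) (openConn s c) (openConn s y)) with hD
  -- non-fractional pairs have zero defect
  have hzero : ∀ e, e ∉ fracEdges v → D e = 0 := by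
    intro e he
    rcases eq_zero_or_one_of_not_mem_fracEdges he with h | h
    · have hu : Function.update v e 0 = v := by rw [← h, Function.update_eq_self]
      simp only [hD, hu, h]
      push_cast
      ring
    · have hu : Function.update v e 1 = v := by rw [← h, Function.update_eq_self]
      simp only [hD, hu, h]
      push_cast
      ring
  have hsum : 0 ≤ ∑ e ∈ fracEdges v, D e := by
    have hsplit := Finset.sum_subset (Finset.subset_univ (fracEdges v)) (f := D) (fun e _ he => hzero e he)
    have h := hAgg v s b c y
    rw [← hsplit] at h
    exact h
  -- a nonnegative sum over a nonempty finite set has a nonnegative term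
  by_contra hneg
  push Not at hneg
  have hlt : ∑ e ∈ fracEdges v, D e < ∑ e ∈ fracEdges v, (0 : ℝ) := by
    apply Finset.sum_lt_sum_of_nonempty hne
    intro e he
    have h := hneg e he
    simp only [hD]
    linarith
  rw [Finset.sum_const_zero] at hlt
  linarith

end IncStar

end Summit.CriticalPhenomena.PercolationContinuityZ3.Theorems

end
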